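import Summits.HubbardSuperconductivity.HubbardSuperconductivity.Theses.JosephsonMirror
import Summits.HubbardSuperconductivity.HubbardSuperconductivity.Theorems.JosephsonMirrorJmPairBridgeSpectralConcentration
import Summits.HubbardSuperconductivity.HubbardSuperconductivity.Theorems.JosephsonMirrorJmPairBridgeLroFloorOfHasLRO
import Summits.HubbardSuperconductivity.HubbardSuperconductivity.Theorems.JosephsonMirrorJmPairBridgePairBridgeAtOfFloors

/-!
# Crux `JmPairBridge` (stmt-HubbardSuperconductivity-2226), line `Sketch` — the conditional reduction

Route `JosephsonMirror`, crux `JmPairBridge` = thesis X (the every-ground-state Penrose–Onsager pair bridge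
`|⟨χ, Δ_d φ⟩|² ≥ a L⁴` between the `(N_L, S^z = 0)` and `(N_L − 2, S^z = 0)` ground floors of
`hubbardTorus 2 L 1 U`, `N_L = 2⌊(1-δ)L²/2⌋`, `Δ_d = pairField dWaveFormFactor L`).

This file composes the three landed stubs of line `Sketch` (card `pair-sum-rule-concentration`) into the
line's THEOREM, the sorry-free conditional reduction of the crux to its residue:

* `jmPairBridge_of_orderAndFloors` : if at some `U > 0`, `δ ∈ (0, 1/2)` the pure Hubbard torus has
  (1) the summit matrix `HasDWavePairFieldLROAt U δ` (every-ground-state `d`-wave pair LRO),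
  (2) the sector gap floor `L² γ_L → ∞` on `(N_L − 2, S^z = 0)` (every vector of that sector orthogonal to
      its ground states pays `≥ e_L(N_L − 2) + C/L²`, for every `C`, eventually in even `L`), and
  (3) the charge-gap convexity floor `e_L(N_L + 2) + e_L(N_L − 2) − 2 e_L(N_L) ≥ −C/L²` eventually,
  then `JmPairBridge` holds.

Ingredients (all proved, imported): `stub_spectralConcentration` (abstract Eckart/Markov capture on an
invariant sector), `stub_lroFloorOfHasLRO` (the summit matrix in uniform-floor form),
`stub_pairBridgeAt_of_floors` (the transfer through the two-sided Koma–Tasaki pair-transfer sum rule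
`Theorems.stub_pairTransferRung`). What is NOT here: any claim that (1)–(3) hold at some point — that is
the registered residue `stub_orderAndFloorsWitness` of the lead skeleton (`Cruxes/JmPairBridge/Lines/Sketch.lean`),
which contains the summit matrix at a point and is crux-sized.

Sources: T. Koma, H. Tasaki, J. Stat. Phys. 76 (1994) 745, Thm 2.2; H. Tasaki, J. Stat. Phys. 174 (2019)
735, §3; H. Tasaki, H. Watanabe (2021), arXiv:2105.10692; C. Eckart, Phys. Rev. 36 (1930) 878;
O. Penrose, L. Onsager, Phys. Rev. 104 (1956) 576; C. N. Yang, Rev. Mod. Phys. 34 (1962) 694.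
No definition, no named fact.
-/

noncomputable section

-- the mandated namespace `Summit.<Summit>.<Problem>.Theorems` repeats `HubbardSuperconductivity`
-- (single-problem summit, D-0017), which the `dupNamespace` linter flags on every declaration
set_option linter.dupNamespace false

namespace Summit.HubbardSuperconductivity.HubbardSuperconductivity.Theorems.JosephsonMirror

open Matrix Literature.MathematicalPhysics.QuantumLattice Literature.Barriers.HubbardSuperconductivity
open Summit.HubbardSuperconductivity.HubbardSuperconductivity.Theses.JosephsonMirror (JmPairBridge)
open scoped ComplexOrder

/-- **The pair bridge at a point from the summit matrix and two spectral floors.** At `0 < δ < 1/2`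
(any real `U`): `HasDWavePairFieldLROAt U δ`, the sector gap floor `L² γ_L → ∞` on `(N_L − 2, S^z = 0)`
and the convexity floor `e_L(N_L+2) + e_L(N_L−2) − 2e_L(N_L) ≥ −C/L²` give `a > 0` and `L₀` such that for
every even `L ≥ L₀`, `L ≠ 0`, every unit ground state `φ` of `hubbardTorus 2 L 1 U` in `(N_L, 0)` has a unit
ground state `χ` of `(N_L − 2, 0)` with `a L⁴ ≤ |⟨χ, Δ_d φ⟩|²` (composition of `stub_lroFloorOfHasLRO`,
`stub_spectralConcentration`, `stub_pairBridgeAt_of_floors`). Koma–Tasaki (1994) Thm 2.2; Eckart (1930).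
[folklore] -/
theorem pairBridgeAt_of_hasLRO_of_floors (U δ : ℝ) (hδ : δ ∈ Set.Ioo (0 : ℝ) (1 / 2))
    (hLRO : HasDWavePairFieldLROAt U δ)
    (hGap : ∀ C : ℝ, ∃ L₀ : ℕ, ∀ (L : ℕ), Even L → L₀ ≤ L →
      ∀ v : Fock (Orb (FermionTorus 2 L)),
        v ∈ szSector (Λ := FermionTorus 2 L) (2 * ⌊(1 - δ) * (L : ℝ) ^ 2 / 2⌋₊ - 2) 0 →
          (∀ χ : Fock (Orb (FermionTorus 2 L)),
              IsGroundStateInSector (hubbardTorus 2 L 1 U) (2 * ⌊(1 - δ) * (L : ℝ) ^ 2 / 2⌋₊ - 2) 0 χ →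
                star χ ⬝ᵥ v = 0) →
            ((hubbardTorus 2 L 1 U).minEnergyOn
                  (szSector (Λ := FermionTorus 2 L) (2 * ⌊(1 - δ) * (L : ℝ) ^ 2 / 2⌋₊ - 2) 0) +
                C / (L : ℝ) ^ 2) * (star v ⬝ᵥ v).re ≤
              (star v ⬝ᵥ hubbardTorus 2 L 1 U *ᵥ v).re)
    (hConv : ∃ C : ℝ, ∃ L₀ : ℕ, ∀ (L : ℕ), Even L → L₀ ≤ L →
      -C / (L : ℝ) ^ 2 ≤
        (hubbardTorus 2 L 1 U).minEnergyOn
            (szSector (Λ := FermionTorus 2 L) (2 * ⌊(1 - δ) * (L : ℝ) ^ 2 / 2⌋₊ + 2) 0) +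
          (hubbardTorus 2 L 1 U).minEnergyOn
            (szSector (Λ := FermionTorus 2 L) (2 * ⌊(1 - δ) * (L : ℝ) ^ 2 / 2⌋₊ - 2) 0) -
          2 * (hubbardTorus 2 L 1 U).minEnergyOn
            (szSector (Λ := FermionTorus 2 L) (2 * ⌊(1 - δ) * (L : ℝ) ^ 2 / 2⌋₊) 0)) :
    ∃ a : ℝ, 0 < a ∧ ∃ L₀ : ℕ, ∀ (L : ℕ) [NeZero L], Even L → L₀ ≤ L →
      ∀ φ : Fock (Orb (FermionTorus 2 L)),
        IsGroundStateInSector (hubbardTorus 2 L 1 U) (2 * ⌊(1 - δ) * (L : ℝ) ^ 2 / 2⌋₊) 0 φ →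
          star φ ⬝ᵥ φ = 1 →
            ∃ χ : Fock (Orb (FermionTorus 2 L)),
              IsGroundStateInSector (hubbardTorus 2 L 1 U) (2 * ⌊(1 - δ) * (L : ℝ) ^ 2 / 2⌋₊ - 2) 0 χ ∧
                star χ ⬝ᵥ χ = 1 ∧
                  a * (L : ℝ) ^ 4 ≤ ‖star χ ⬝ᵥ Matrix.mulVec (pairField dWaveFormFactor L) φ‖ ^ 2 :=
  stub_pairBridgeAt_of_floors
    (fun _ _ _ H K γ v hH hK hKne hγ hgap hv => stub_spectralConcentration H K γ v hH hK hKne hγ hgap hv)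
    U δ hδ (stub_lroFloorOfHasLRO U δ hδ.1.le hLRO) hGap hConv

/-- **The conditional reduction of the crux `JmPairBridge` (line `Sketch`).** If at some `U > 0`,
`δ ∈ (0, 1/2)` the pure Hubbard torus carries (1) the summit matrix `HasDWavePairFieldLROAt U δ`,
(2) the `(N_L − 2, S^z = 0)` sector gap floor `L² γ_L → ∞` and (3) the charge-gap convexity floor
`≥ −C/L²`, then the every-ground-state Penrose–Onsager pair bridge `JmPairBridge` holds. The hypothesis
is exactly the registered residue `stub_orderAndFloorsWitness` of the lead skeleton; it contains the summit
matrix at a point (crux-sized) and is NOT claimed here. Koma–Tasaki (1994) Thm 2.2; Tasaki (2019) §3;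
Penrose–Onsager (1956); Yang (1962). [folklore] -/
theorem jmPairBridge_of_orderAndFloors
    (h : ∃ U : ℝ, 0 < U ∧ ∃ δ ∈ Set.Ioo (0 : ℝ) (1 / 2),
      HasDWavePairFieldLROAt U δ ∧
      (∀ C : ℝ, ∃ L₀ : ℕ, ∀ (L : ℕ), Even L → L₀ ≤ L →
        ∀ v : Fock (Orb (FermionTorus 2 L)),
          v ∈ szSector (Λ := FermionTorus 2 L) (2 * ⌊(1 - δ) * (L : ℝ) ^ 2 / 2⌋₊ - 2) 0 →
            (∀ χ : Fock (Orb (FermionTorus 2 L)),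
                IsGroundStateInSector (hubbardTorus 2 L 1 U) (2 * ⌊(1 - δ) * (L : ℝ) ^ 2 / 2⌋₊ - 2) 0 χ →
                  star χ ⬝ᵥ v = 0) →
              ((hubbardTorus 2 L 1 U).minEnergyOn
                    (szSector (Λ := FermionTorus 2 L) (2 * ⌊(1 - δ) * (L : ℝ) ^ 2 / 2⌋₊ - 2) 0) +
                  C / (L : ℝ) ^ 2) * (star v ⬝ᵥ v).re ≤
                (star v ⬝ᵥ hubbardTorus 2 L 1 U *ᵥ v).re) ∧
      (∃ C : ℝ, ∃ L₀ : ℕ, ∀ (L : ℕ), Even L → L₀ ≤ L →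
        -C / (L : ℝ) ^ 2 ≤
          (hubbardTorus 2 L 1 U).minEnergyOn
              (szSector (Λ := FermionTorus 2 L) (2 * ⌊(1 - δ) * (L : ℝ) ^ 2 / 2⌋₊ + 2) 0) +
            (hubbardTorus 2 L 1 U).minEnergyOn
              (szSector (Λ := FermionTorus 2 L) (2 * ⌊(1 - δ) * (L : ℝ) ^ 2 / 2⌋₊ - 2) 0) -
            2 * (hubbardTorus 2 L 1 U).minEnergyOn
              (szSector (Λ := FermionTorus 2 L) (2 * ⌊(1 - δ) * (L : ℝ) ^ 2 / 2⌋₊) 0))) :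
    JmPairBridge := by
  obtain ⟨U, hU, δ, hδ, hLRO, hGap, hConv⟩ := h
  obtain ⟨a, ha, L₀, hbr⟩ := pairBridgeAt_of_hasLRO_of_floors U δ hδ hLRO hGap hConv
  exact ⟨U, hU, δ, hδ, a, ha, L₀, fun L _ hL hL₀ φ hφ hφ1 => hbr L hL hL₀ φ hφ hφ1⟩

end Summit.HubbardSuperconductivity.HubbardSuperconductivity.Theorems.JosephsonMirror

end
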